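import Mathlib
import HarnessLib
import Summits.HubbardSuperconductivity.HubbardSuperconductivity.Theorems.KLProgrammeKLRegimeVolumeLimitDefs
import Summits.HubbardSuperconductivity.HubbardSuperconductivity.Theorems.KLProgrammeKLRegimeTwoPointAssemblyRepr
import Summits.HubbardSuperconductivity.HubbardSuperconductivity.Theorems.KLProgrammeKLRegimeTwoPointAssemblyDiag
import Summits.HubbardSuperconductivity.HubbardSuperconductivity.Theorems.KLProgrammeKLRegimeTwoPointAssemblyFree
import Summits.HubbardSuperconductivity.HubbardSuperconductivity.Theorems.KLProgrammeKLRegimeTwoPointAssemblyInt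
import Summits.HubbardSuperconductivity.HubbardSuperconductivity.Theorems.KLProgrammeKLRegimeTwoPointAssemblyFrame
import Summits.HubbardSuperconductivity.HubbardSuperconductivity.Theorems.KLProgrammeKLRegimeTwoPointAssemblyStubAsmMatsubara
import Summits.HubbardSuperconductivity.HubbardSuperconductivity.Theorems.KLProgrammeKLRegimeTwoPointAssemblyStubAsmPartition
import Summits.HubbardSuperconductivity.HubbardSuperconductivity.Theorems.KLProgrammeKLRegimeSplitGenericV3
import Literature.Probability.LatticeModels.TorusCentredLift

/-!
# Child 4 does not read the tower's Matsubara threshold: `TwoPointAssemblyP3 Pr VL W` for EVERY volume-limit slot `VL` that implies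
# `∃ Mstar', FinalTwoLegVolLimit β U μ K Mstar'` (seat hubbard-kl-k3c5-p2, g2 — evidence for the VL-slot observation of HOME/STATUS)

Route `KLProgramme`, crux K3 (route-file-FREE imports: the stubs' modules, not `…TwoPointAssemblyV7`).  The composition of child 4
(`…TwoPointAssemblyV7.twoPointAssemblyP3_of`, r2d-p2; re-closed on V11 by k3c5-p1)
consumes the volume-limit text only through `stub_asm_int β hβ U μ K Mstar hVL`, whose conclusion `∃ L₁ … ∃ M₁ ∀ M M' ≥ M₁ …` carries its own
Matsubara threshold; neither the tower `TowerP` nor the admissibility of the frame is read.  Hence: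

* `tendsto_hubbardThermalTwoPoint_of_finalTwoLegVolLimit` — the Pr/W/tower-FREE core: for `β > 0` and ANY `(U, μ, K, Mstar)` with
  `FinalTwoLegVolLimit β U μ K Mstar`, the equal-time thermal two-point functions `hubbardThermalTwoPoint β U (μ + U/2) L x y σ σ'` converge as
  `L → ∞` (r2d-p2's proof verbatim, the threshold an argument);
* `twoPointAssemblyP3_of_slot` — `TwoPointAssemblyP3 Pr VL W` for every slot `VL` with `VL β U μ K Ms → ∃ Ms', FinalTwoLegVolLimit β U μ K Ms'`;
* `twoPointAssemblyP3_existsThreshold` — in particular for the slot `fun β U μ K _ => ∃ Mstar', FinalTwoLegVolLimit β U μ K Mstar'`, the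
  ONE-TOKEN re-typing of child 5's conclusion under which clause (i) of the VL text carries the PROVER's Matsubara threshold instead of the
  tower's (the tower's `Mstar` is visible to child 5 only through `TowerP`, whose slots do not bound `klSelfEnergy … (nScales β + 1)` at general
  `(ω, k)`): child 4 closes verbatim under it.  Everything is proved; no definition.
-/

noncomputable section

namespace Summit.HubbardSuperconductivity.HubbardSuperconductivity.Theorems.TwoPointAssembly

set_option linter.dupNamespace false -- summit = problem name (single-conjunct summit), D-0017

open Real Finset Filter Topology Literature.MathematicalPhysics.QuantumLattice Literature.Probability.LatticeModels
open GrassmannAlgebra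
open Summit.HubbardSuperconductivity.HubbardSuperconductivity.Theorems.KLRegimeSplit
open Summit.HubbardSuperconductivity.HubbardSuperconductivity.Theorems.KLProgrammeLegKernels

/-- **The tower-free core of child 4**: for `β > 0` and any `(U, μ, K, Mstar)` with `FinalTwoLegVolLimit β U μ K Mstar`, the equal-time thermal
two-point functions at the physical potential `μ + U/2` converge as `L → ∞` (r2d-p2's `twoPointAssemblyP3_of`, threshold as an argument). -/
theorem tendsto_hubbardThermalTwoPoint_of_finalTwoLegVolLimit {β : ℝ} (hβ : 0 < β) (U μ : ℝ) (K : TrigPolyC4v) (Mstar : ℕ → ℕ)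
    (hVL : FinalTwoLegVolLimit β U μ K Mstar) (x y : Site 2) (σ σ' : Fin 2) :
    ∃ S : ℂ, Tendsto (fun L : ℕ => hubbardThermalTwoPoint β U (μ + U / 2) L x y σ σ') atTop (𝓝 S) := by
  -- (route-cone-free copies of r2d-p2's two bookkeeping lemmas of `…TwoPointAssemblyV7`, as local facts)
  have halfDelta_ev : ∀ᶠ L : ℕ in atTop,
      (if σ = σ' ∧ Torus.proj L x = Torus.proj L y then (1 / 2 : ℂ) else 0) = halfDelta σ σ' x y := by
    have hb : ∃ B : ℕ, ∀ j, |x j - y j| < (B : ℤ) := by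
      refine ⟨(∑ j, |x j - y j|).toNat + 1, fun j => ?_⟩
      have h1 : |x j - y j| ≤ ∑ i, |x i - y i| := Finset.single_le_sum (fun i _ => abs_nonneg (x i - y i)) (Finset.mem_univ j)
      have h2 : (∑ i, |x i - y i|) ≤ ((∑ i, |x i - y i|).toNat : ℤ) := Int.self_le_toNat _
      push_cast
      linarith
    obtain ⟨B, hB⟩ := hb
    filter_upwards [eventually_ge_atTop B] with L hL
    have hlt : ∀ j, |x j - y j| < (L : ℤ) := fun j => lt_of_lt_of_le (hB j) (by exact_mod_cast hL)
    rw [halfDelta]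
    exact if_congr (Iff.and Iff.rfl ⟨fun h => Torus.proj_injective_of_abs_sub_lt hlt h, fun h => by rw [h]⟩) rfl rfl
  have ratio_ev : ∀ (L : ℕ) [NeZero L], 3 ≤ L → ∀ (xe ye : TorusSite 2 L), ∀ᶠ M : ℕ in atTop,
      grassmannRatio L M β U μ σ σ' xe ye = reprFree L M β μ K σ σ' xe ye + reprInt L M β U μ K σ σ' xe ye := by
    intro L _ hL xe ye
    filter_upwards [stub_asm_partition L hL β hβ μ U, eventually_ge_atTop 1] with M hZ hM
    haveI : NeZero M := ⟨by omega⟩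
    obtain ⟨N, hN, hframe⟩ := stub_asm_frame L M β hβ μ U K
    have hden : effPartitionFn ℂ (hubbardCovarianceCT L M β μ 0 K) (hubbardInteractionCT L M β U K) =
        N * effPartitionFn ℂ (hubbardCovariance L M β μ 0) (hubbardInteraction L M β U) := by
      rw [effPartitionFn_eq_gaussExpect, effPartitionFn_eq_gaussExpect, ← one_mul (grassmannExp _), hframe 1, one_mul]
    have hZK : effPartitionFn ℂ (hubbardCovarianceCT L M β μ 0 K) (hubbardInteractionCT L M β U K) ≠ 0 := by
      rw [hden]; exact mul_ne_zero hN hZ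
    have hrepr := stub_asm_repr L M β U μ K σ σ' xe ye hZK
    rw [← stub_asm_diag L M β hβ U μ K σ σ' xe ye, grassmannRatio]
    rw [hframe (twoPointInsertion L M β σ σ' xe ye), hden] at hrepr
    rw [div_eq_iff hZ]
    apply mul_left_cancel₀ hN
    rw [hrepr]; ring
  obtain ⟨fM, F, hfM, hF⟩ := stub_asm_free β hβ μ K σ σ' x y
  have hint := stub_asm_int β hβ U μ K Mstar hVL σ σ' x y
  -- `u L = T_L − ½δ_L`, the `M`-limit of the bare ratio at `L ≥ 3`
  set u : ℕ → ℂ := fun L => hubbardThermalTwoPoint β U (μ + U / 2) L x y σ σ' -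
    (if σ = σ' ∧ Torus.proj L x = Torus.proj L y then (1 / 2 : ℂ) else 0) with hu
  -- `w L = u L − fM L`, the `M`-limit of the interacting part
  set w : ℕ → ℂ := fun L => u L - fM L with hw
  have hwlim : ∀ (L : ℕ) [NeZero L], 3 ≤ L →
      Tendsto (fun M : ℕ => reprInt L M β U μ K σ σ' (Torus.proj L x) (Torus.proj L y)) atTop (𝓝 (w L)) := by
    intro L _ hL
    have hmats := stub_asm_matsubara L hL β hβ μ U σ σ' x y
    have h1 : Tendsto (fun M : ℕ => grassmannRatio L M β U μ σ σ' (Torus.proj L x) (Torus.proj L y) -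
        reprFree L M β μ K σ σ' (Torus.proj L x) (Torus.proj L y)) atTop (𝓝 (u L - fM L)) := hmats.sub (hfM L hL)
    refine h1.congr' ?_
    filter_upwards [ratio_ev L hL (Torus.proj L x) (Torus.proj L y)] with M hM
    rw [hM]; ring
  -- `w` is Cauchy
  have hwC : CauchySeq fun n : ℕ => w (n + 3) := by
    rw [Metric.cauchySeq_iff]
    intro ε hε
    obtain ⟨L₁, hL₁⟩ := hint (ε / 2) (half_pos hε)
    refine ⟨L₁, fun m hm n hn => ?_⟩
    haveI : NeZero (m + 3) := ⟨by omega⟩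
    haveI : NeZero (n + 3) := ⟨by omega⟩
    obtain ⟨M₁, hM₁⟩ := hL₁ (m + 3) (n + 3) (by omega) (by omega)
    have hev : ∀ᶠ M : ℕ in atTop, ‖reprInt (m + 3) M β U μ K σ σ' (Torus.proj (m + 3) x) (Torus.proj (m + 3) y) -
        reprInt (n + 3) M β U μ K σ σ' (Torus.proj (n + 3) x) (Torus.proj (n + 3) y)‖ ≤ ε / 2 := by
      filter_upwards [eventually_ge_atTop (max M₁ 1)] with M hM
      haveI : NeZero M := ⟨by have := le_of_max_le_right hM; omega⟩
      exact hM₁ M M (le_of_max_le_left hM) (le_of_max_le_left hM)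
    have hlim := ((hwlim (m + 3) (by omega)).sub (hwlim (n + 3) (by omega))).norm
    have hle : ‖w (m + 3) - w (n + 3)‖ ≤ ε / 2 := le_of_tendsto hlim hev
    rw [dist_eq_norm]; linarith
  obtain ⟨Wlim, hW⟩ := cauchySeq_tendsto_of_complete hwC
  have hW' : Tendsto w atTop (𝓝 Wlim) := by
    rw [← tendsto_add_atTop_iff_nat 3]; exact hW
  -- assemble: `T_L = u L + ½δ_L = w L + fM L + ½δ_L`
  obtain ⟨L₂, hL₂⟩ := halfDelta_ev.exists_forall_of_atTop
  refine ⟨Wlim + F + halfDelta σ σ' x y, ?_⟩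
  have hsum : Tendsto (fun L => w L + fM L + halfDelta σ σ' x y) atTop (𝓝 (Wlim + F + halfDelta σ σ' x y)) :=
    (hW'.add hF).add tendsto_const_nhds
  refine hsum.congr' ?_
  filter_upwards [eventually_ge_atTop L₂] with L hL
  simp only [hw, hu, hL₂ L hL]
  ring

/-- **Child 4 for EVERY slot that implies the VL text at SOME threshold**: if `VL β U μ K Ms → ∃ Ms', FinalTwoLegVolLimit β U μ K Ms'` for all
arguments, then `TwoPointAssemblyP3 Pr VL W` (every bundle `Pr`, every window `W`). -/
theorem twoPointAssemblyP3_of_slot (Pr : Preds) (VL : VolLimitSlot) (W : Set ℝ)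
    (hVL : ∀ (β U μ : ℝ) (K : TrigPolyC4v) (Ms : ℕ → ℕ), VL β U μ K Ms → ∃ Ms' : ℕ → ℕ, FinalTwoLegVolLimit β U μ K Ms') :
    TwoPointAssemblyP3 Pr VL W := by
  intro G P Q R _ _ _ _ c _
  refine ⟨1, one_pos, ?_⟩
  intro μ _ U _ _ β hβmin _ Lstar Mstar hyp x y σ σ'
  obtain ⟨K, _, _, hK⟩ := hyp
  obtain ⟨Ms', hVL'⟩ := hVL β U μ K Mstar hK
  exact tendsto_hubbardThermalTwoPoint_of_finalTwoLegVolLimit (pos_of_klBetaMin_le hβmin) U μ K Ms' hVL' x y σ σ'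

/-- **Child 4 under the ONE-TOKEN re-typing of child 5's conclusion**: with the slot `fun β U μ K _ => ∃ Mstar', FinalTwoLegVolLimit β U μ K Mstar'`
(clause (i) carries the prover's own Matsubara threshold), `TwoPointAssemblyP3 Pr _ W` holds for every bundle and window. -/
theorem twoPointAssemblyP3_existsThreshold (Pr : Preds) (W : Set ℝ) :
    TwoPointAssemblyP3 Pr (fun β U μ K _ => ∃ Mstar' : ℕ → ℕ, FinalTwoLegVolLimit β U μ K Mstar') W :=
  twoPointAssemblyP3_of_slot Pr _ W fun _ _ _ _ _ h => h

-- (r2d-p2's `twoPointAssemblyP3_of Pr W` is the special case `Ms' := Ms` of `twoPointAssemblyP3_of_slot`.)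

end Summit.HubbardSuperconductivity.HubbardSuperconductivity.Theorems.TwoPointAssembly

end
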